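import Mathlib.Analysis.SpecialFunctions.Log.Basic
import Mathlib.Analysis.SpecialFunctions.Pow.Real
import Mathlib.Data.Nat.Log
import Mathlib.Topology.MetricSpace.Basic
import HarnessLib

/-!
# Transfer of a one-arm exponent between two block decompositions

Topic `Literature/Probability/Percolation`; proofs only (no definition, no named fact). The
elementary real-analysis step by which arm EXPONENTS of critical percolation are compared once
the arm probabilities are known to be *quasi-multiplicative* along geometric scales (P. Nolin,
*Near-critical percolation in two dimensions*, EJP 13 (2008), §4.5 (quasi-multiplicativity,
Prop. 13 [arXiv: Prop. 12]) and the way exponents are read off in §4.7 / proof of Thm. 27: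
"`π(N) ≍ ∏ blocks`, so that `log π(λ^K) = Σ_k log b_k + O(K)`"). Abstractly:

Let `π₁, π₂ : ℕ → (0, ∞)` be non-increasing, `C ≥ 1`, and suppose that for every integer ratio
`L ≥ L₀` there are scales `L^k ≤ N_o(k) ≤ 2 L^k` and block values `q_o(k) ∈ [c_L, 1]` (`o = 1, 2`)
with, for all large `k`,
* (quasi-multiplicativity) `C⁻¹ π_o(N_o k) q_o(k) ≤ π_o(N_o(k+1)) ≤ C π_o(N_o k) q_o(k)`, and
* (the blocks agree up to a factor `2`) `q₂(k) ≤ 2 q₁(k)`, `q₁(k) ≤ 2 q₂(k)`.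
Then `(log π₂(n) - log π₁(n)) / log n → 0` (`tendsto_log_sub_log_div_log`): along `L^k` the two
logarithms differ by at most `K (log 2 + 2 log C) + O_L(1)` while `log n ≥ K log L`, and `L` is
arbitrary. In the tree this is fed (file `…RotationTransfer`) with the axis and diagonal
half-plane one-arm probabilities of bond percolation on `ℤ²`, whose blocks are the
Schramm–Smirnov crossing probabilities of a half-annulus quad and of its rotation by `π/4`, equal
up to `1 + o(1)` by the rotation invariance of Duminil-Copin–Kozlowski–Krachun–Manolescu–Oulamara.

## References

* P. Nolin, EJP 13 (2008), §4.5, §4.7. [Nolin2008]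
-/

noncomputable section

namespace Literature.Probability.Percolation

open Filter Topology Real

namespace HalfPlaneArm

/-- One step of the chain in logarithms: `|log π(N(k+1)) - log π(N k) - log q k| ≤ log C`.
[folklore] -/
theorem abs_log_step_le {a b q C : ℝ} (ha : 0 < a) (hb : 0 < b) (hq : 0 < q) (hC : 1 ≤ C)
    (h1 : b ≤ C * a * q) (h2 : a * q ≤ C * b) : |Real.log b - Real.log a - Real.log q| ≤ Real.log C := by
  have hC0 : 0 < C := by linarith
  rw [abs_le]
  constructor
  · have := Real.log_le_log (by positivity) h2
    rw [Real.log_mul ha.ne' hq.ne', Real.log_mul hC0.ne' hb.ne'] at this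
    linarith
  · have := Real.log_le_log hb h1
    rw [Real.log_mul (by positivity) hq.ne', Real.log_mul hC0.ne' ha.ne'] at this
    linarith

/-- The telescoped chain: `|log π(N(k₀+j)) - log π(N k₀) - Σ_{i<j} log q(k₀+i)| ≤ j log C`.
[folklore] -/
theorem abs_log_chain_le {f : ℕ → ℝ} {N : ℕ → ℕ} {q : ℕ → ℝ} {C : ℝ} {k₀ : ℕ}
    (hpos : ∀ n, 0 < f n) (hq : ∀ k, k₀ ≤ k → 0 < q k) (hC : 1 ≤ C)
    (h : ∀ k, k₀ ≤ k → f (N (k + 1)) ≤ C * f (N k) * q k ∧ f (N k) * q k ≤ C * f (N (k + 1))) (j : ℕ) :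
    |Real.log (f (N (k₀ + j))) - Real.log (f (N k₀)) -
      ∑ i ∈ Finset.range j, Real.log (q (k₀ + i))| ≤ j * Real.log C := by
  induction j with
  | zero => simp
  | succ j ih =>
    have hk : k₀ ≤ k₀ + j := Nat.le_add_right _ _
    have step := abs_log_step_le (hpos (N (k₀ + j))) (hpos (N (k₀ + j + 1))) (hq _ hk) hC (h _ hk).1 (h _ hk).2
    rw [Finset.sum_range_succ, Nat.cast_succ, add_mul, one_mul, show k₀ + (j + 1) = k₀ + j + 1 by ring]
    calc |Real.log (f (N (k₀ + j + 1))) - Real.log (f (N k₀)) -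
          (∑ i ∈ Finset.range j, Real.log (q (k₀ + i)) + Real.log (q (k₀ + j)))|
        = |(Real.log (f (N (k₀ + j))) - Real.log (f (N k₀)) - ∑ i ∈ Finset.range j, Real.log (q (k₀ + i))) +
            (Real.log (f (N (k₀ + j + 1))) - Real.log (f (N (k₀ + j))) - Real.log (q (k₀ + j)))| := by ring_nf
      _ ≤ _ := abs_add_le _ _
      _ ≤ j * Real.log C + Real.log C := add_le_add ih step

/-- **Transfer of the exponent between two quasi-multiplicative chains.** See the module
docstring. [cite: Nolin2008, §4.5 and §4.7 (exponents from quasi-multiplicativity)] -/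
theorem tendsto_log_sub_log_div_log {π₁ π₂ : ℕ → ℝ} (hpos₁ : ∀ n, 0 < π₁ n) (hpos₂ : ∀ n, 0 < π₂ n)
    (hanti₁ : ∀ m n, m ≤ n → π₁ n ≤ π₁ m) (hanti₂ : ∀ m n, m ≤ n → π₂ n ≤ π₂ m)
    {C : ℝ} (hC : 1 ≤ C) (L₀ : ℕ)
    (hchain : ∀ L : ℕ, L₀ ≤ L → 2 ≤ L → ∃ (N₁ N₂ : ℕ → ℕ) (q₁ q₂ : ℕ → ℝ) (k₀ : ℕ) (cq : ℝ), 0 < cq ∧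
      (∀ k, k₀ ≤ k → L ^ k ≤ N₁ k ∧ N₁ k ≤ 2 * L ^ k ∧ L ^ k ≤ N₂ k ∧ N₂ k ≤ 2 * L ^ k) ∧
      (∀ k, k₀ ≤ k → cq ≤ q₁ k ∧ q₁ k ≤ 1 ∧ cq ≤ q₂ k ∧ q₂ k ≤ 1) ∧
      (∀ k, k₀ ≤ k → q₂ k ≤ 2 * q₁ k ∧ q₁ k ≤ 2 * q₂ k) ∧
      (∀ k, k₀ ≤ k → π₁ (N₁ (k + 1)) ≤ C * π₁ (N₁ k) * q₁ k ∧ π₁ (N₁ k) * q₁ k ≤ C * π₁ (N₁ (k + 1))) ∧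
      (∀ k, k₀ ≤ k → π₂ (N₂ (k + 1)) ≤ C * π₂ (N₂ k) * q₂ k ∧ π₂ (N₂ k) * q₂ k ≤ C * π₂ (N₂ (k + 1)))) :
    Tendsto (fun n : ℕ => (Real.log (π₂ n) - Real.log (π₁ n)) / Real.log n) atTop (𝓝 0) := by
  rw [Metric.tendsto_atTop]
  intro η hη
  have hC0 : 0 < C := by linarith
  have hlogC : 0 ≤ Real.log C := Real.log_nonneg hC
  -- the per-step discrepancy and the ratio `L`
  set B : ℝ := Real.log 2 + 2 * Real.log C with hB
  have hB0 : 0 ≤ B := by have := Real.log_nonneg (show (1 : ℝ) ≤ 2 by norm_num); positivity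
  obtain ⟨L, hLL₀, hL2, hLB⟩ : ∃ L : ℕ, L₀ ≤ L ∧ 2 ≤ L ∧ 2 * B / η + 1 ≤ Real.log L := by
    refine ⟨max (max L₀ 2) ⌈Real.exp (2 * B / η + 1)⌉₊, le_trans (le_max_left _ _) (le_max_left _ _),
      le_trans (le_max_right _ _) (le_max_left _ _), ?_⟩
    have h1 : Real.exp (2 * B / η + 1) ≤ (max (max L₀ 2) ⌈Real.exp (2 * B / η + 1)⌉₊ : ℕ) := by
      refine (Nat.le_ceil _).trans ?_
      exact_mod_cast le_max_right _ _
    have := Real.log_le_log (Real.exp_pos _) h1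
    rwa [Real.log_exp] at this
  have hL1 : 1 < L := by omega
  have hLpos : (0 : ℝ) < L := by exact_mod_cast (show 0 < L by omega)
  have hlogL : 0 < Real.log L := Real.log_pos (by exact_mod_cast hL1)
  have hBL : B / Real.log L < η / 2 := by
    rw [div_lt_iff₀ hlogL]
    have : 2 * B / η < Real.log L := by linarith
    rw [div_lt_iff₀ hη] at this
    linarith
  obtain ⟨N₁, N₂, q₁, q₂, k₀, cq, hcq, hN, hq, hqq, h₁, h₂⟩ := hchain L hLL₀ hL2
  -- logarithms along the chains
  set ℓ₁ : ℕ → ℝ := fun k => Real.log (π₁ (N₁ k)) with hℓ₁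
  set ℓ₂ : ℕ → ℝ := fun k => Real.log (π₂ (N₂ k)) with hℓ₂
  have hq₁ : ∀ k, k₀ ≤ k → 0 < q₁ k := fun k hk => hcq.trans_le (hq k hk).1
  have hq₂ : ∀ k, k₀ ≤ k → 0 < q₂ k := fun k hk => hcq.trans_le (hq k hk).2.2.1
  have chain₁ := abs_log_chain_le (N := N₁) hpos₁ hq₁ hC h₁
  have chain₂ := abs_log_chain_le (N := N₂) hpos₂ hq₂ hC h₂
  -- the two sums of logarithms differ by at most `j log 2`
  have hsum : ∀ j, |∑ i ∈ Finset.range j, Real.log (q₂ (k₀ + i)) - ∑ i ∈ Finset.range j, Real.log (q₁ (k₀ + i))| ≤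
      j * Real.log 2 := by
    intro j
    rw [← Finset.sum_sub_distrib]
    refine (Finset.abs_sum_le_sum_abs _ _).trans ?_
    have : ∀ i ∈ Finset.range j, |Real.log (q₂ (k₀ + i)) - Real.log (q₁ (k₀ + i))| ≤ Real.log 2 := by
      intro i _
      have hk : k₀ ≤ k₀ + i := Nat.le_add_right _ _
      obtain ⟨a1, a2⟩ := hqq _ hk
      rw [abs_le]
      constructor
      · have := Real.log_le_log (hq₁ _ hk) a2
        rw [Real.log_mul (by norm_num) (hq₂ _ hk).ne'] at this; linarith
      · have := Real.log_le_log (hq₂ _ hk) a1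
        rw [Real.log_mul (by norm_num) (hq₁ _ hk).ne'] at this; linarith
    refine (Finset.sum_le_sum this).trans ?_
    rw [Finset.sum_const, Finset.card_range, nsmul_eq_mul]
  -- the two chains stay within `A₀ + j B`
  set A₀ : ℝ := |ℓ₂ k₀ - ℓ₁ k₀| with hA₀
  have hdiff : ∀ j, |ℓ₂ (k₀ + j) - ℓ₁ (k₀ + j)| ≤ A₀ + j * B := by
    intro j
    have c1 := chain₁ j
    have c2 := chain₂ j
    have s := hsum j
    rw [abs_le] at c1 c2 s ⊢
    simp only [hℓ₁, hℓ₂] at *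
    have hA : -A₀ ≤ Real.log (π₂ (N₂ k₀)) - Real.log (π₁ (N₁ k₀)) ∧
        Real.log (π₂ (N₂ k₀)) - Real.log (π₁ (N₁ k₀)) ≤ A₀ := abs_le.1 le_rfl
    constructor <;> nlinarith
  -- one step changes `ℓ` by at most `W`
  set W : ℝ := Real.log C - Real.log cq with hW
  have hW0 : 0 ≤ W := by
    have : Real.log cq ≤ 0 := Real.log_nonpos hcq.le ((hq k₀ le_rfl).1.trans (hq k₀ le_rfl).2.1)
    linarith
  have hstep₁ : ∀ k, k₀ ≤ k → |ℓ₁ (k + 1) - ℓ₁ k| ≤ W := by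
    intro k hk
    have s := abs_log_step_le (hpos₁ (N₁ k)) (hpos₁ (N₁ (k + 1))) (hq₁ k hk) hC (h₁ k hk).1 (h₁ k hk).2
    have l1 : Real.log cq ≤ Real.log (q₁ k) := Real.log_le_log hcq (hq k hk).1
    have l2 : Real.log (q₁ k) ≤ 0 := Real.log_nonpos (hq₁ k hk).le (hq k hk).2.1
    rw [abs_le] at s ⊢
    simp only [hℓ₁]
    constructor <;> linarith
  have hstep₂ : ∀ k, k₀ ≤ k → |ℓ₂ (k + 1) - ℓ₂ k| ≤ W := by
    intro k hk
    have s := abs_log_step_le (hpos₂ (N₂ k)) (hpos₂ (N₂ (k + 1))) (hq₂ k hk) hC (h₂ k hk).1 (h₂ k hk).2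
    have l1 : Real.log cq ≤ Real.log (q₂ k) := Real.log_le_log hcq (hq k hk).2.2.1
    have l2 : Real.log (q₂ k) ≤ 0 := Real.log_nonpos (hq₂ k hk).le (hq k hk).2.2.2
    rw [abs_le] at s ⊢
    simp only [hℓ₂]
    constructor <;> linarith
  -- choice of `n₀`
  obtain ⟨K₁, hK₁⟩ : ∃ K₁ : ℕ, (2 * W + A₀ + B) / (Real.log L) < (η / 2) * K₁ := by
    obtain ⟨K₁, hK₁⟩ := exists_nat_gt ((2 * W + A₀ + B) / Real.log L / (η / 2))
    exact ⟨K₁, by rw [div_lt_iff₀ (by positivity)] at hK₁; linarith⟩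
  refine ⟨L ^ (max (k₀ + 2) K₁), fun n hn => ?_⟩
  have hn0 : n ≠ 0 := by
    have : 0 < L ^ (max (k₀ + 2) K₁) := pow_pos (by omega) _
    omega
  set K := Nat.log L n with hK
  have hKge : max (k₀ + 2) K₁ ≤ K := Nat.le_log_of_pow_le hL1 hn
  have hk₀K : k₀ + 2 ≤ K := le_trans (le_max_left _ _) hKge
  have hK₁K : K₁ ≤ K := le_trans (le_max_right _ _) hKge
  have hLK : L ^ K ≤ n := Nat.pow_log_le_self L hn0
  have hnL : n < L ^ (K + 1) := Nat.lt_pow_succ_log_self hL1 n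
  -- `log n ≥ K log L`
  have hlogn : (K : ℝ) * Real.log L ≤ Real.log n := by
    rw [← Real.log_pow]
    exact Real.log_le_log (by positivity) (by exact_mod_cast hLK)
  have hKpos : (0 : ℝ) < K := by exact_mod_cast (show 0 < K by omega)
  have hlogn0 : 0 < Real.log n := lt_of_lt_of_le (by positivity) hlogn
  -- sandwich `log π_o n` between `ℓ_o (K+1)` and `ℓ_o (K-1)`
  obtain ⟨j, hj⟩ : ∃ j, K = k₀ + j + 1 := ⟨K - k₀ - 1, by omega⟩
  have hjK : k₀ ≤ k₀ + j := Nat.le_add_right _ _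
  have up₁ : Real.log (π₁ n) ≤ ℓ₁ (k₀ + j) := by
    refine Real.log_le_log (hpos₁ _) (hanti₁ _ _ ?_)
    have := (hN (k₀ + j) hjK).2.1
    calc N₁ (k₀ + j) ≤ 2 * L ^ (k₀ + j) := this
      _ ≤ L * L ^ (k₀ + j) := Nat.mul_le_mul_right _ hL2
      _ = L ^ K := by rw [hj, pow_succ]; ring
      _ ≤ n := hLK
  have up₂ : Real.log (π₂ n) ≤ ℓ₂ (k₀ + j) := by
    refine Real.log_le_log (hpos₂ _) (hanti₂ _ _ ?_)
    have := (hN (k₀ + j) hjK).2.2.2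
    calc N₂ (k₀ + j) ≤ 2 * L ^ (k₀ + j) := this
      _ ≤ L * L ^ (k₀ + j) := Nat.mul_le_mul_right _ hL2
      _ = L ^ K := by rw [hj, pow_succ]; ring
      _ ≤ n := hLK
  have lo₁ : ℓ₁ (K + 1) ≤ Real.log (π₁ n) := by
    refine Real.log_le_log (hpos₁ _) (hanti₁ _ _ ?_)
    exact le_trans hnL.le (hN (K + 1) (by omega)).1
  have lo₂ : ℓ₂ (K + 1) ≤ Real.log (π₂ n) := by
    refine Real.log_le_log (hpos₂ _) (hanti₂ _ _ ?_)
    exact le_trans hnL.le (hN (K + 1) (by omega)).2.2.1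
  -- hence `|log π_o n - ℓ_o K| ≤ W` and the main estimate
  have d₁ : |Real.log (π₁ n) - ℓ₁ K| ≤ W := by
    have s1 := hstep₁ (k₀ + j) hjK
    have s2 := hstep₁ K (by omega)
    rw [show k₀ + j + 1 = K by omega] at s1
    rw [abs_le] at s1 s2 ⊢
    constructor <;> linarith
  have d₂ : |Real.log (π₂ n) - ℓ₂ K| ≤ W := by
    have s1 := hstep₂ (k₀ + j) hjK
    have s2 := hstep₂ K (by omega)
    rw [show k₀ + j + 1 = K by omega] at s1
    rw [abs_le] at s1 s2 ⊢
    constructor <;> linarith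
  have main : |Real.log (π₂ n) - Real.log (π₁ n)| ≤ 2 * W + A₀ + K * B := by
    have hd := hdiff (j + 1)
    rw [show k₀ + (j + 1) = K by omega] at hd
    have hjB : ((j + 1 : ℕ) : ℝ) * B ≤ K * B := by
      refine mul_le_mul_of_nonneg_right ?_ hB0
      exact_mod_cast (show j + 1 ≤ K by omega)
    rw [abs_le] at d₁ d₂ hd ⊢
    constructor <;> linarith
  -- conclusion
  rw [Real.dist_eq, sub_zero, abs_div, abs_of_pos hlogn0, div_lt_iff₀ hlogn0]
  have e1 : 2 * W + A₀ + K * B < (η / 2) * (K * Real.log L) + K * B := by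
    have : (2 * W + A₀ + B) < (η / 2) * K₁ * Real.log L := by
      rw [div_lt_iff₀ hlogL] at hK₁; linarith
    have hK₁' : (K₁ : ℝ) ≤ K := by exact_mod_cast hK₁K
    nlinarith [mul_le_mul_of_nonneg_right hK₁' (by positivity : 0 ≤ (η / 2) * Real.log L)]
  have e2 : (K : ℝ) * B ≤ (η / 2) * (K * Real.log L) := by
    have := hBL.le
    rw [div_le_iff₀ hlogL] at this
    nlinarith
  calc |Real.log (π₂ n) - Real.log (π₁ n)| ≤ 2 * W + A₀ + K * B := main
    _ < (η / 2) * (K * Real.log L) + (η / 2) * (K * Real.log L) := by linarith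
    _ = η * (K * Real.log L) := by ring
    _ ≤ η * Real.log n := by gcongr

end HalfPlaneArm

end Literature.Probability.Percolation
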